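import Summits.ResolutionOfSingularities.ResolutionOfSingularities.Theorems.PurelyInseparableDim4Perm2BoundExcess
import HarnessLib

/-!
# [OURS · res-dim4-pi PR-2, part 6a] When is the translated bound `d′ + g ≤ 2d + p^{e−1}` ATTAINED?
  The transfer identity with its slack, the tightness criterion, «attained ⟺ tight ∧ maximal Moh jump of
  the point blow-up», and the class of record `e = 1` («⟺ tight ∧ kangaroo point»)

Cell `res-dim4-pi` (D-0157 DOOR 2), lineage **PR-2** (seat `res-dim4-p-2`, generation 3), part 6 of the series
`…Perm2BoundOrigin` (p646720) · `…Perm2Bound` (p647736) · `…Perm2BoundTranslated` (p648595) · `…Perm2BoundExcess`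
(p662116) · `…Perm2BoundSharp`/`…SharpStep` (p662205/p662814). Notation of parts 1–5: a state `(F, r, exc)` of the
tree's coordinate-centre walk (`CentreBlowup.CState`; `x^r ∣ F` monomialwise), `o = ord₀ F`, `d = o − |r|` the shade,
a coordinate centre `V(z, x_S)` under Hauser–Perlega's condition (1) ONLY (`q ≤ degIn S e` on every monomial), chart
`j ∈ S`, a point `b` of the `x_j`-chart OVER THE ORIGIN of the centre (`b_j = 0`, `b = 0` off `S`),
`g = ord_{(x_S)} F − Σ_{i∈S} r_i`; `F′` = the new residual polynomial (`(CentreBlowup.step q S j b s).F`), `d′` its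
shade; `F′_pt`, `d′_pt` the same for the POINT blow-up with the same chart and point (`PointBlowup.step q j b (F, r)`);
`N = σ ∖ S` the variables off the centre. Part 3 proved the transfer `d′ + g ≤ d′_pt + d` and, at `q = p^e`,
`d′ + g ≤ 2d + p^{e−1}`; part 4 what an excess `d′ + g > 2d` forces; part 5 a family attaining `+p^{e−1}`; part 4's
honest-scope line said «No attained iff». This file supplies it, in the only form the mathematics allows (the
point-level maximal jump is Hauser's kangaroo phenomenon, characterised in print by NECESSARY conditions only):

## What is proved

§1 (every `q`) **THE TRANSFER IDENTITY WITH ITS SLACK.** `φ : x_i ↦ x_j x_i (i ∉ S)` carries `F′` to `F′_pt`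
(the tree's `CentreBlowup.lift_step_F`) and preserves the exponents off `S`; hence
`ord₀ F′_pt = min over the monomials x^E of F′ of (|E| + Σ_{i∉S} E_i) ≥ ord₀ F′ + Σ_{i∉S} r_i`
(`le_ordZero_pointStep`), and with `slack := ord₀ F′_pt − ord₀ F′ − Σ_{i∉S} r_i ∈ ℕ`:
* **`shade_step_add_add_slack_eq` : `d′ + g + slack = d′_pt + d`** (part 3's inequality is `slack ≥ 0`);
* **`ordZero_pointStep_eq_add_iff` : `slack = 0 ⟺` the INITIAL FORM of `F′` contains a monomial `x^E` with
  `E_i = r_i` for every `i ∉ S`** (the variables off the centre occur in it exactly through the exceptional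
  monomial — the least the divisibility `x^{r′} ∣ F′`, `r′_i = r_i` off `S`, allows); call such an edge TIGHT;
* `shade_step_add_eq_shade_pointStep_add_iff` : `d′ + g = d′_pt + d ⟺` tight.
§2 (`q = p^e`, `e ≥ 1`, `char K = p`, `F` clean)
* **`shade_step_add_eq_two_mul_add_pow_iff` : `d′ + g = 2d + p^{e−1} ⟺ tight ∧ d′_pt = d + p^{e−1}`** — the
  translated PERM2-0 bound of part 3 is attained EXACTLY at the tight edges whose point blow-up (same chart, same
  point) realises Moh's maximal jump `+p^{e−1}` [Moh 1987; Hauser–Perlega 2019 (9)];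
* **`shade_step_add_eq_two_mul_add_one_iff`** (THE CLASS OF RECORD `e = 1`): **`d′ + g = 2d + 1 ⟺ tight ∧
  PointBlowup.ShadeIncreases p j b (F, r)`** — every «+1 out of band» PERM2-0 edge of the census (crit-3
  BANK-A3-01: 15 such edges) is a KANGAROO POINT of the point blow-up at the same point read through a tight
  transfer, and conversely; in particular all of Hauser–Perlega's necessary conditions (part 4,
  `necessary_of_two_mul_lt`; the tree's `PointBlowup.necessary_of_shadeIncreases`) apply to it.
§3 the `e = 1` criterion in the cell's letters (`PIDim4.State`, `IsPermissibleCentre`):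
`shade_add_ordAlong_eq_add_one_iff`. (The finer Hasse-probe bounds `d′ + g ≤ 2d + min(p^k, r_{i₀})` /
`2d + p^ℓ` are part 6b, `…Perm2BoundProbes`.)

## What is NOT proved (honest scope)
«Tight» is a condition on the OUTPUT initial form `in(F′)` (which monomials of `F` become initial after chart,
translation and cleaning is the whole difficulty, exactly as for kangaroo points); no input-side characterisation of
the point-level maximal jump beyond the printed necessary conditions is claimed — there is none in print
(presearch: corpus «residual order increase characterization blowup positive characteristic» → [corpus:
HauserPerlega2019PRIMS §3] necessary conditions (1)–(7) + bound (9); galaxy «kangaroo point|residual order» →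
Hauser BAMS 2010 §G (Kangaroo Theorem, necessary conditions); no iff). Points moving ALONG the centre are brick
PR-1. [OURS · counted 0 · AI work weaker than expert review] NOTHING here proves resolution of singularities in
dimension ≥ 4 / characteristic `p`: exact bookkeeping of the letter `d` of OUR candidate frame (MODE 1h coordinate
game); census value (classifies the translated PERM2-0 excess population by the point-blow-up kangaroo population).
bears_on: LADDER-RESOLUTION:D157-DOOR2 (res-dim4-pi · PR-2). Supports stmt-ResolutionOfSingularities-16155 (helper).
-/

noncomputable section

set_option linter.dupNamespace false -- mandated namespace of this single-conjunct summit
open MvPolynomial Finset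
open scoped BigOperators
namespace Summit.ResolutionOfSingularities.ResolutionOfSingularities.Theorems.PIDim4
namespace Perm2Bound
open Literature.AlgebraicGeometry.Resolution
open Literature.AlgebraicGeometry.Resolution.CentreBlowup
open Literature.AlgebraicGeometry.Resolution.Hauser2010
open Literature.Barriers.ResolutionOfSingularities (ordZero_le_of_coeff_ne_zero le_ordZero_of_forall)

/-! ### §1 The transfer identity with its slack, and the tightness criterion (every `q`) -/

section Slack
variable {σ : Type*} {K : Type*} [Field K] [Fintype σ] [DecidableEq σ] [DecidableEq K]

/-- **`ord₀ F′_pt ≥ ord₀ F′ + Σ_{i∉S} r_i`** (every `q`; `x^r ∣ F`, condition (1), `ord_{(x_S)} F = Σ_S r_i + g`,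
point over the origin of the centre): `φ : x_i ↦ x_j x_i (i ∉ S)` maps `F′` onto `F′_pt` and raises the degree
of `x^E` by `Σ_{i∉S} E_i ≥ Σ_{i∉S} r_i`. (`Σ_{i∉S} r_i` is written `|r| − degIn S r`.) [folklore] -/
theorem le_ordZero_pointStep {q : ℕ} {S : Finset σ} {j : σ} (hj : j ∈ S) (b : σ → K) (hbj : b j = 0)
    (hbN : ∀ i, i ∉ S → b i = 0) (s : CState σ K) {o : ℕ} (ho : ordZero s.F = o)
    (hr : ∀ d ∈ s.F.support, s.r ≤ d) (hq : ∀ d ∈ s.F.support, q ≤ degIn S d) {g : ℕ}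
    (hg : ordAlong S s.F = ((degIn S s.r + g : ℕ) : ℕ∞)) {oG : ℕ}
    (hoG : ordZero (step q S j b s).F = oG) :
    ((oG + (s.r.degree - degIn S s.r) : ℕ) : ℕ∞) ≤ ordZero (PointBlowup.step q j b s.toState).F := by
  have hφ := lift_step_F q hj b hbj hbN s hq
  obtain ⟨-, hN⟩ := degree_step_r_transfer b hbj s ho hr hq hg
  have hr1 := step_r_le_of_mem_support_step q S j b hbj s hr
  have hrN : ∀ e ∈ (step q S j b s).F.support, s.r.degree - degIn S s.r ≤ e.degree - degIn S e := by
    intro e he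
    have hle := hr1 e he
    have h1 := degIn_add_sum_compl S e
    have h2 := degIn_add_sum_compl S s.r
    have h3 : ∑ i ∈ Sᶜ, s.r i ≤ ∑ i ∈ Sᶜ, e i := Finset.sum_le_sum fun i hi => by
      have hi' : i ∉ S := Finset.mem_compl.mp hi
      have hij : i ≠ j := fun h => hi' (h ▸ hj)
      rw [← hN i hij (hbN i hi')]
      exact Finsupp.le_def.mp hle i
    omega
  have hlift := le_ordZero_lift S j (step q S j b s).F hoG hrN
  rwa [hφ] at hlift

/-- **THE TRANSFER IDENTITY WITH ITS SLACK** (every `q`): with `slack = ord₀ F′_pt − ord₀ F′ − Σ_{i∉S} r_i`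
(a natural number by `le_ordZero_pointStep`), **`d′ + g + slack = d′_pt + d`** — part 3's
`shade_step_add_le_shade_pointStep_add` is the inequality `slack ≥ 0`; the bookkeeping is
`|r′_pt| + Σ_S r_i + g = |r′| + o` (`degree_step_r_transfer`). [folklore] -/
theorem shade_step_add_add_slack_eq {q : ℕ} {S : Finset σ} {j : σ} (hj : j ∈ S) (b : σ → K)
    (hbj : b j = 0) (hbN : ∀ i, i ∉ S → b i = 0) (s : CState σ K) {o : ℕ} (ho : ordZero s.F = o)
    (hr : ∀ d ∈ s.F.support, s.r ≤ d) (hq : ∀ d ∈ s.F.support, q ≤ degIn S d) {g : ℕ}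
    (hg : ordAlong S s.F = ((degIn S s.r + g : ℕ) : ℕ∞)) {oG : ℕ}
    (hoG : ordZero (step q S j b s).F = oG) {o₁ : ℕ}
    (ho₁ : ordZero (PointBlowup.step q j b s.toState).F = o₁) :
    oG + (s.r.degree - degIn S s.r) ≤ o₁ ∧
      (step q S j b s).shade + (g : ℕ∞) + ((o₁ - (oG + (s.r.degree - degIn S s.r)) : ℕ) : ℕ∞) =
        (PointBlowup.step q j b s.toState).shade + s.shade := by
  obtain ⟨hdeg, -⟩ := degree_step_r_transfer b hbj s ho hr hq hg
  have hlift := le_ordZero_pointStep hj b hbj hbN s ho hr hq hg hoG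
  rw [ho₁] at hlift
  have hlift' : oG + (s.r.degree - degIn S s.r) ≤ o₁ := by exact_mod_cast hlift
  have hr1 := step_r_le_of_mem_support_step q S j b hbj s hr
  -- `|r′| ≤ ord₀ F′`, `|r′_pt| ≤ ord₀ F′_pt`, `|r| ≤ o`
  obtain ⟨⟨E₁, hE₁, hE₁deg⟩, -⟩ := (ordZero_eq_nat_iff _ _).mp hoG
  have hrle : (step q S j b s).r.degree ≤ oG :=
    hE₁deg ▸ PointBlowup.degree_le_degree_of_le (hr1 E₁ (MvPolynomial.mem_support_iff.mpr hE₁))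
  obtain ⟨⟨E₂, hE₂, hE₂deg⟩, -⟩ := (ordZero_eq_nat_iff _ _).mp ho₁
  have hrle₂ : (PointBlowup.step q j b s.toState).r.degree ≤ o₁ :=
    hE₂deg ▸ PointBlowup.degree_le_degree_of_le
      (PointBlowup.newMult_le_of_mem_support_step q j b hbj s.toState ho hr E₂
        (MvPolynomial.mem_support_iff.mpr hE₂))
  obtain ⟨⟨d₀, hd₀, hd₀deg⟩, -⟩ := (ordZero_eq_nat_iff _ _).mp ho
  have hro : s.r.degree ≤ o :=
    hd₀deg ▸ PointBlowup.degree_le_degree_of_le (hr d₀ (MvPolynomial.mem_support_iff.mpr hd₀))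
  have hSle := degIn_le_degree S s.r
  refine ⟨hlift', ?_⟩
  rw [CState.shade_eq_of_ordZero_eq _ hoG, PointBlowup.shade_eq_of_ordZero_eq _ ho₁,
    CState.shade_eq_of_ordZero_eq s ho]
  exact_mod_cast (show oG - (step q S j b s).r.degree + g + (o₁ - (oG + (s.r.degree - degIn S s.r))) =
    (o₁ - (PointBlowup.step q j b s.toState).r.degree) + (o - s.r.degree) by omega)

/-- **THE TIGHTNESS CRITERION** (every `q`): the slack vanishes, `ord₀ F′_pt = ord₀ F′ + Σ_{i∉S} r_i`, iff the
INITIAL FORM of `F′` contains a monomial `x^E` (`|E| = ord₀ F′`) whose exponents off the centre are exactly the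
exceptional ones, `E_i = r_i` for all `i ∉ S` (`φ` is injective on monomials, `CentreBlowup.coeff_lift`, and
raises degrees by `Σ_{i∉S} E_i`, `degree_lift`; `E_i ≥ r′_i = r_i` off `S`). [folklore] -/
theorem ordZero_pointStep_eq_add_iff {q : ℕ} {S : Finset σ} {j : σ} (hj : j ∈ S) (b : σ → K)
    (hbj : b j = 0) (hbN : ∀ i, i ∉ S → b i = 0) (s : CState σ K) {o : ℕ} (ho : ordZero s.F = o)
    (hr : ∀ d ∈ s.F.support, s.r ≤ d) (hq : ∀ d ∈ s.F.support, q ≤ degIn S d) {g : ℕ}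
    (hg : ordAlong S s.F = ((degIn S s.r + g : ℕ) : ℕ∞)) {oG : ℕ}
    (hoG : ordZero (step q S j b s).F = oG) {o₁ : ℕ}
    (ho₁ : ordZero (PointBlowup.step q j b s.toState).F = o₁) :
    o₁ = oG + (s.r.degree - degIn S s.r) ↔
      ∃ E ∈ (step q S j b s).F.support, E.degree = oG ∧ ∀ i, i ∉ S → E i = s.r i := by
  have hφ := lift_step_F q hj b hbj hbN s hq
  obtain ⟨-, hN⟩ := degree_step_r_transfer b hbj s ho hr hq hg
  have hr1 := step_r_le_of_mem_support_step q S j b hbj s hr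
  have hlift := le_ordZero_pointStep hj b hbj hbN s ho hr hq hg hoG
  rw [ho₁] at hlift
  have hlift' : oG + (s.r.degree - degIn S s.r) ≤ o₁ := by exact_mod_cast hlift
  have h2 := degIn_add_sum_compl S s.r
  -- off `S` every monomial of `F′` dominates `r`, coordinatewise
  have hoff : ∀ E ∈ (step q S j b s).F.support, ∀ i ∈ Sᶜ, s.r i ≤ E i := by
    intro E hE i hi
    have hi' : i ∉ S := Finset.mem_compl.mp hi
    have hij : i ≠ j := fun h => hi' (h ▸ hj)
    rw [← hN i hij (hbN i hi')]
    exact Finsupp.le_def.mp (hr1 E hE) i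
  have hrN : ∀ e ∈ (step q S j b s).F.support, s.r.degree - degIn S s.r ≤ e.degree - degIn S e := by
    intro e he
    have h1 := degIn_add_sum_compl S e
    have h3 : ∑ i ∈ Sᶜ, s.r i ≤ ∑ i ∈ Sᶜ, e i := Finset.sum_le_sum (hoff e he)
    omega
  -- `codeg E = Σ_{i∉S} r_i` iff `E_i = r_i` off `S`
  have hcodeg : ∀ E ∈ (step q S j b s).F.support,
      (E.degree - degIn S E = s.r.degree - degIn S s.r ↔ ∀ i, i ∉ S → E i = s.r i) := by
    intro E hE
    have h1 := degIn_add_sum_compl S E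
    have hiff := Finset.sum_eq_sum_iff_of_le (hoff E hE)
    constructor
    · intro h i hi
      have hsum : ∑ i ∈ Sᶜ, s.r i = ∑ i ∈ Sᶜ, E i := by omega
      exact ((hiff.mp hsum) i (Finset.mem_compl.mpr hi)).symm
    · intro h
      have hsum : ∑ i ∈ Sᶜ, s.r i = ∑ i ∈ Sᶜ, E i :=
        hiff.mpr fun i hi => (h i (Finset.mem_compl.mp hi)).symm
      omega
  constructor
  · intro heq
    -- pull an initial monomial of `F′_pt` back through `φ`
    obtain ⟨⟨E₂, hE₂, hE₂deg⟩, -⟩ := (ordZero_eq_nat_iff _ _).mp ho₁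
    have hE₂s : E₂ ∈ (PointBlowup.step q j b s.toState).F.support := MvPolynomial.mem_support_iff.mpr hE₂
    rw [← hφ] at hE₂s
    obtain ⟨E, hE, hψ⟩ := exists_of_mem_support_lift S j _ hE₂s
    have hdeg : (E + Finsupp.single j (E.degree - degIn S E)).degree = oG + (s.r.degree - degIn S s.r) := by
      rw [hψ, hE₂deg, heq]
    obtain ⟨hEdeg, hEco⟩ := degree_eq_of_lift_initial S j _ hoG hrN hE hdeg
    exact ⟨E, hE, hEdeg, (hcodeg E hE).mp hEco⟩
  · rintro ⟨E, hE, hEdeg, hEi⟩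
    have hco : E.degree - degIn S E = s.r.degree - degIn S s.r := (hcodeg E hE).mpr hEi
    have hc : coeff (E + Finsupp.single j (E.degree - degIn S E)) (PointBlowup.step q j b s.toState).F ≠ 0 := by
      rw [← hφ, coeff_lift hj]
      exact MvPolynomial.mem_support_iff.mp hE
    have hle := ordZero_le_of_coeff_ne_zero _ _ hc
    rw [ho₁, degree_lift, hco, hEdeg] at hle
    have hle' : o₁ ≤ oG + (s.r.degree - degIn S s.r) := by exact_mod_cast hle
    omega

/-- **TRANSFER EQUALITY ⟺ TIGHT** (every `q`): `d′ + g = d′_pt + d` iff the initial form of `F′` contains a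
monomial with `E_i = r_i` for all `i ∉ S`. [folklore] -/
theorem shade_step_add_eq_shade_pointStep_add_iff {q : ℕ} {S : Finset σ} {j : σ} (hj : j ∈ S)
    (b : σ → K) (hbj : b j = 0) (hbN : ∀ i, i ∉ S → b i = 0) (s : CState σ K) {o : ℕ}
    (ho : ordZero s.F = o) (hr : ∀ d ∈ s.F.support, s.r ≤ d)
    (hq : ∀ d ∈ s.F.support, q ≤ degIn S d) {g : ℕ}
    (hg : ordAlong S s.F = ((degIn S s.r + g : ℕ) : ℕ∞)) {oG : ℕ}
    (hoG : ordZero (step q S j b s).F = oG) :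
    (step q S j b s).shade + (g : ℕ∞) = (PointBlowup.step q j b s.toState).shade + s.shade ↔
      ∃ E ∈ (step q S j b s).F.support, E.degree = oG ∧ ∀ i, i ∉ S → E i = s.r i := by
  have hφ := lift_step_F q hj b hbj hbN s hq
  have hpt0 : (PointBlowup.step q j b s.toState).F ≠ 0 := by
    rw [← hφ]
    exact lift_ne_zero hj (ne_zero_of_ordZero_eq_natCast hoG)
  obtain ⟨o₁, ho₁⟩ := exists_ordZero_eq_natCast hpt0
  obtain ⟨hle, hid⟩ := shade_step_add_add_slack_eq hj b hbj hbN s ho hr hq hg hoG ho₁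
  rw [← ordZero_pointStep_eq_add_iff hj b hbj hbN s ho hr hq hg hoG ho₁]
  rw [CState.shade_eq_of_ordZero_eq _ hoG, PointBlowup.shade_eq_of_ordZero_eq _ ho₁,
    CState.shade_eq_of_ordZero_eq s ho] at hid ⊢
  have hid' : oG - (step q S j b s).r.degree + g + (o₁ - (oG + (s.r.degree - degIn S s.r))) =
      (o₁ - (PointBlowup.step q j b s.toState).r.degree) + (o - s.r.degree) := by exact_mod_cast hid
  constructor
  · intro h
    have h' : oG - (step q S j b s).r.degree + g =
        (o₁ - (PointBlowup.step q j b s.toState).r.degree) + (o - s.r.degree) := by exact_mod_cast h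
    omega
  · intro h
    exact_mod_cast (show oG - (step q S j b s).r.degree + g =
      (o₁ - (PointBlowup.step q j b s.toState).r.degree) + (o - s.r.degree) by omega)

end Slack

/-! ### §2 At order `q = p^e`: attained ⟺ tight ∧ maximal Moh jump; the class of record `e = 1` -/

section PrimePower

variable {σ : Type*} {K : Type*} [Field K] [Fintype σ] [DecidableEq σ] [DecidableEq K]
variable (p : ℕ) [hp : Fact p.Prime] [CharP K p]

/-- **`d′ + g = 2d + p^{e−1} ⟺ TIGHT ∧ d′_pt = d + p^{e−1}`** (`q = p^e`, `e ≥ 1`, clean `F`, `x^r ∣ F`,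
condition (1), point over the origin of the centre): the translated PERM2-0 bound of part 3
(`shade_step_add_le_two_mul_add_pow`) is an equality exactly when the transfer is tight (§1) AND the point
blow-up with the same chart and point realises Moh's maximal jump `+p^{e−1}` (`PointBlowup.mohBound`).
[cite: Moh1987, Stability Theorem (one permissible blow-up), §1 Propositions 1–2]
[cite: HauserPerlega2019PRIMS, §3 Theorem (9)] -/
theorem shade_step_add_eq_two_mul_add_pow_iff {e : ℕ} (he : 1 ≤ e) {S : Finset σ} {j : σ} (hj : j ∈ S)
    (b : σ → K) (hbj : b j = 0) (hbN : ∀ i, i ∉ S → b i = 0) (s : CState σ K)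
    (hclean : deletePthPowers (p ^ e) s.F = s.F) {o : ℕ} (ho : ordZero s.F = o)
    (hr : ∀ d ∈ s.F.support, s.r ≤ d) (hq : ∀ d ∈ s.F.support, p ^ e ≤ degIn S d) {g : ℕ}
    (hg : ordAlong S s.F = ((degIn S s.r + g : ℕ) : ℕ∞)) :
    (step (p ^ e) S j b s).shade + (g : ℕ∞) = 2 * s.shade + ((p ^ (e - 1) : ℕ) : ℕ∞) ↔
      (∃ E ∈ (step (p ^ e) S j b s).F.support,
          (E.degree : ℕ∞) = ordZero (step (p ^ e) S j b s).F ∧ ∀ i, i ∉ S → E i = s.r i) ∧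
        (PointBlowup.step (p ^ e) j b s.toState).shade = s.shade + ((p ^ (e - 1) : ℕ) : ℕ∞) := by
  have hs : s.toState.shade = s.shade := rfl
  by_cases ht : (step (p ^ e) S j b s).F = 0
  · -- degenerate: `F′ = 0` makes the left side `⊤ = finite` and the right side an empty existential
    have h1 : (step (p ^ e) S j b s).shade = ⊤ := by
      unfold CState.shade; rw [ht, ordZero_zero, ENat.top_sub_coe]
    rw [h1, top_add, ht, MvPolynomial.support_zero, CState.shade_eq_of_ordZero_eq s ho]
    constructor
    · intro h
      exact absurd h.symm (by exact_mod_cast ENat.coe_ne_top _)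
    · rintro ⟨⟨E, hE, -⟩, -⟩
      exact absurd hE (Finset.notMem_empty E)
  obtain ⟨oG, hoG⟩ := exists_ordZero_eq_natCast ht
  have hφ := lift_step_F (p ^ e) hj b hbj hbN s hq
  have hpt0 : (PointBlowup.step (p ^ e) j b s.toState).F ≠ 0 := by
    rw [← hφ]; exact lift_ne_zero hj ht
  obtain ⟨o₁, ho₁⟩ := exists_ordZero_eq_natCast hpt0
  obtain ⟨hle, hid⟩ := shade_step_add_add_slack_eq hj b hbj hbN s ho hr hq hg hoG ho₁
  have hcrit := ordZero_pointStep_eq_add_iff hj b hbj hbN s ho hr hq hg hoG ho₁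
  -- Moh's bound for the point step
  have hord : ((p ^ e : ℕ) : ℕ∞) ≤ ordZero s.F := by
    obtain ⟨⟨d₀, hd₀, hd₀deg⟩, -⟩ := (ordZero_eq_nat_iff _ _).mp ho
    have k1 := hq d₀ (MvPolynomial.mem_support_iff.mpr hd₀)
    have k2 := degIn_le_degree S d₀
    rw [ho]
    exact_mod_cast (show p ^ e ≤ o by omega)
  have hM := PointBlowup.mohBound p he j b hbj s.toState hclean hord hr
  unfold PointBlowup.MohBound at hM
  rw [hs] at hM
  -- the criterion with `ordZero F′` in place of `oG`
  have hcrit' : (∃ E ∈ (step (p ^ e) S j b s).F.support,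
      (E.degree : ℕ∞) = ordZero (step (p ^ e) S j b s).F ∧ ∀ i, i ∉ S → E i = s.r i) ↔
      o₁ = oG + (s.r.degree - degIn S s.r) := by
    rw [hcrit, hoG]
    constructor
    · rintro ⟨E, hE, hEdeg, hEi⟩
      exact ⟨E, hE, by exact_mod_cast hEdeg, hEi⟩
    · rintro ⟨E, hE, hEdeg, hEi⟩
      exact ⟨E, hE, by exact_mod_cast hEdeg, hEi⟩
  rw [hcrit']
  rw [CState.shade_eq_of_ordZero_eq _ hoG, PointBlowup.shade_eq_of_ordZero_eq _ ho₁,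
    CState.shade_eq_of_ordZero_eq s ho] at hid ⊢
  rw [PointBlowup.shade_eq_of_ordZero_eq _ ho₁, CState.shade_eq_of_ordZero_eq s ho] at hM
  set A := (step (p ^ e) S j b s).r.degree with hA
  set B := (PointBlowup.step (p ^ e) j b s.toState).r.degree with hB
  set M := p ^ (e - 1) with hMdef
  have hid' : oG - A + g + (o₁ - (oG + (s.r.degree - degIn S s.r))) = (o₁ - B) + (o - s.r.degree) := by
    exact_mod_cast hid
  have hM' : o₁ - B ≤ (o - s.r.degree) + M := by exact_mod_cast hM
  constructor
  · intro h
    have h' : oG - A + g = 2 * (o - s.r.degree) + M := by exact_mod_cast h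
    refine ⟨by omega, ?_⟩
    exact_mod_cast (show o₁ - B = (o - s.r.degree) + M by omega)
  · rintro ⟨hx, hpt⟩
    have hpt' : o₁ - B = (o - s.r.degree) + M := by exact_mod_cast hpt
    exact_mod_cast (show oG - A + g = 2 * (o - s.r.degree) + M by omega)

/-- **THE CLASS OF RECORD `e = 1`: `d′ + g = 2d + 1 ⟺ TIGHT ∧ the point blow-up at the same point is a
KANGAROO (its shade increases)`** (`q = p`, clean `F`, `x^r ∣ F`, condition (1), point over the origin of the
centre). At order `p` Moh's jump is at most `1` (`PointBlowup.mohBound`, `e = 1`), so «maximal jump» = «the shade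
increases» = `PointBlowup.ShadeIncreases p j b (F, r)`; the «+1 out of band» PERM2-0 edges of the census are
exactly the tight edges over kangaroo points of point blow-ups. [cite: Moh1987, Stability Theorem, §1 (p. 972)]
[cite: HauserPerlega2019PRIMS, §3 Theorem (9) and Comment (d)] [cite: Hauser2010, §F Proposition (Moh), §G] -/
theorem shade_step_add_eq_two_mul_add_one_iff {S : Finset σ} {j : σ} (hj : j ∈ S) (b : σ → K)
    (hbj : b j = 0) (hbN : ∀ i, i ∉ S → b i = 0) (s : CState σ K)
    (hclean : deletePthPowers p s.F = s.F) {o : ℕ} (ho : ordZero s.F = o)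
    (hr : ∀ d ∈ s.F.support, s.r ≤ d) (hq : ∀ d ∈ s.F.support, p ≤ degIn S d) {g : ℕ}
    (hg : ordAlong S s.F = ((degIn S s.r + g : ℕ) : ℕ∞)) :
    (step p S j b s).shade + (g : ℕ∞) = 2 * s.shade + 1 ↔
      (∃ E ∈ (step p S j b s).F.support,
          (E.degree : ℕ∞) = ordZero (step p S j b s).F ∧ ∀ i, i ∉ S → E i = s.r i) ∧
        PointBlowup.ShadeIncreases p j b s.toState := by
  have h5 := shade_step_add_eq_two_mul_add_pow_iff p (e := 1) le_rfl hj b hbj hbN s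
    (by rw [pow_one]; exact hclean) ho hr (by simpa only [pow_one] using hq) hg
  simp only [pow_one, Nat.sub_self, pow_zero, Nat.cast_one] at h5
  rw [h5]
  have hs : s.toState.shade = s.shade := rfl
  -- Moh at `e = 1`: `d′_pt ≤ d + 1`
  have hord : ((p ^ 1 : ℕ) : ℕ∞) ≤ ordZero s.F := by
    obtain ⟨⟨d₀, hd₀, hd₀deg⟩, -⟩ := (ordZero_eq_nat_iff _ _).mp ho
    have k1 := hq d₀ (MvPolynomial.mem_support_iff.mpr hd₀)
    have k2 := degIn_le_degree S d₀
    rw [ho, pow_one]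
    exact_mod_cast (show p ≤ o by omega)
  have hM := PointBlowup.mohBound p (e := 1) le_rfl j b hbj s.toState (by rw [pow_one]; exact hclean) hord hr
  unfold PointBlowup.MohBound at hM
  simp only [pow_one, Nat.sub_self, pow_zero, Nat.cast_one] at hM
  rw [hs] at hM
  have hfin : s.shade ≠ ⊤ := by
    rw [CState.shade_eq_of_ordZero_eq s ho]; exact ENat.coe_ne_top _
  refine and_congr Iff.rfl ?_
  unfold PointBlowup.ShadeIncreases
  rw [hs]
  constructor
  · intro h
    rw [h]
    exact (ENat.lt_add_one_iff hfin).mpr le_rfl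
  · intro hlt
    exact le_antisymm hM ((ENat.add_one_le_iff hfin).mpr hlt)

end PrimePower
end Perm2Bound

/-! ### §3 In the cell's vocabulary (`e = 1`, class (4,1)) -/

section Cell
open Literature.AlgebraicGeometry.Resolution
open Literature.AlgebraicGeometry.Resolution.CentreBlowup
open Literature.AlgebraicGeometry.Resolution.Hauser2010
variable {K : Type} [Field K] [DecidableEq K] (p : ℕ) [Fact p.Prime] [CharP K p]

/-- **The `+1` of the translated bound in the cell's letters, class (4,1), `q = p`**: for a clean presented state
with `x^r ∣ F ≠ 0`, a Hironaka-permissible centre `S ∋ j` (condition (1) only) and a point `b` of the `x_j`-chart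
over the origin of the centre, **`d′ + ordAlong S F = 2d + degIn S r + 1`** (the bound
`Perm2Bound.shade_add_ordAlong_le_add_pow` at `e = 1` attained) **iff the edge is TIGHT and the point blow-up at
the same point is a kangaroo** (`PointBlowup.ShadeIncreases p j b (F, r)`). [OURS · about the candidate frame]
[cite: Moh1987, Stability Theorem, §1 (p. 972)] [cite: HauserPerlega2019PRIMS, §3 Theorem (9) and Comment (d)] -/
theorem shade_add_ordAlong_eq_add_one_iff {S : Finset (Fin 4)} {j : Fin 4} (hj : j ∈ S) (b : Fin 4 → K)
    (hbj : b j = 0) (hbN : ∀ i, i ∉ S → b i = 0) (s : State K) (hF : s.F ≠ 0)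
    (hclean : deletePthPowers p s.F = s.F) (hr : ∀ d ∈ s.F.support, s.r ≤ d)
    (hS : IsPermissibleCentre p S s.F) :
    (CentreBlowup.step p S j b s).shade + ordAlong S s.F = 2 * s.shade + degIn S s.r + 1 ↔
      (∃ E ∈ (CentreBlowup.step p S j b s).F.support,
          (E.degree : ℕ∞) = ordZero (CentreBlowup.step p S j b s).F ∧ ∀ i, i ∉ S → E i = s.r i) ∧
        PointBlowup.ShadeIncreases p j b s.toState := by
  obtain ⟨o, ho⟩ := exists_ordZero_eq_natCast hF
  obtain ⟨g, hg⟩ := exists_ordAlong_eq_add S s hF hr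
  have hq := forall_le_degIn_of_isPermissibleCentre hS
  rw [← Perm2Bound.shade_step_add_eq_two_mul_add_one_iff p hj b hbj hbN s hclean ho hr hq hg]
  have e1 : (CentreBlowup.step p S j b s).shade + ordAlong S s.F =
      ((CentreBlowup.step p S j b s).shade + (g : ℕ∞)) + (degIn S s.r : ℕ∞) := by
    rw [hg, Nat.cast_add]; ring
  have e2 : 2 * s.shade + (degIn S s.r : ℕ∞) + 1 = (2 * s.shade + 1) + (degIn S s.r : ℕ∞) := by ring
  rw [e1, e2]
  exact (ENat.add_left_injective_of_ne_top (ENat.coe_ne_top (degIn S s.r))).eq_iff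

end Cell

end Summit.ResolutionOfSingularities.ResolutionOfSingularities.Theorems.PIDim4

end
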